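import Summits.CriticalPhenomena.PercolationContinuityZ3.Theorems.Transplant.SkelFrmFrom1RootHoldsQ3VRPx
import Summits.CriticalPhenomena.PercolationContinuityZ3.Theorems.Transplant.SkelFrmFromBChoiceSlotsPx
import HarnessLib

/-!
# U_s execution (RULING D-Us / Us-R3 / Us-R5 / Us-R6, lead g22 2026-08-26; WAVE-Us-MANIFEST v1.0 §3/§5): «SkelFrmFrom1RootHoldsQ3VNodePx» — **THE GEN (R) COLUMN TOP,
# ∀ D, AT THE TUPLE OF RECORD UNDER PROXIES** — `PlanarSkeletonFrmFrom.NegB.rootHoldsNQWFnLKPxAt_frmChoiceAllQ3VPx_node (D Kmin) (hKmin : 200 ≤ Kmin) :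
# RootHoldsNQWFnLKPxAt LfQ Kmin (frmChoiceAllQ3VPx D (gvPx D) (fvPx D) (PvPx D) (SUS (exPx D) (mxPx D)) (cvPx D) (hvPx D) BSlot.small3)` — the (R) obligation the
# U_s node reads BY NAME (1 of 4; p465608's shape `hR := fun D => … D 480 (by norm_num)`)

builds on p205010 (kernel theorem, internal audit signed; external expert review pending) — nothing in this file uses p205010; NOTHING is claimed about the
OPEN node U_s `SamePDropOfSkeletonFrmScaled₁` until the node file lands.  Lane `prim-bschramm`, seat `prim-bschramm-p3` gen 27 (design owner; (R)-column pen
by RULING Us-R3); helper file (`--supports stmt-CriticalPhenomena-4575 --as helper`); GEN column top (NEW TEXT of the U top «SkelFrmFrom1RootHoldsQ3VNode»'s shape).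
PROOF = the U top's proof READ AT THE RAISED INDEX `m′ := KS.RK t Dr 0 + D` («SkelFrmFromBChoiceSlotsPx» TUPLE Px OF RECORD: every slot is the U constructor at
`m′`): over «SkelFrmFrom1RootHoldsQ3VRPx» §3 (`rootHoldsNQWFnLKPxAt_frmChoiceAllQ3VPx_R D Kmin 0 …`) the nine hypotheses are discharged by the U floor lemmas
AT `m′` — HgR: `gxC_floors … Dr m′` through `le_gT_gxQ m′ …` and `two_fT_le_gT m′ …`; HfR: `le_fT_fxQ m′ …`; HexR: `le_exQ m′ (exRD m′ D) …` then `exRD_floors`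
(the two `+ D` window rows) and `exR0_floors … m′` (the four index-only rows); HPx: `subset_PR_PxQ m′ …`; HRs: `RA'_le_r_TA … Dr m′ …` + `KS.T₀a_lt_RA' … Dr m′`;
HX1/HXA/HX2/HYA: `rowX1_Q/rowXA_Q/rowX2_Q/rowYA_Q … O.merged … m′ …` + `bOf_small3_eq` (the B-slot `BSlot.small3` STANDS — read planarly only).
[cite: KozmaNitzan2024, §4 p. 28 ((32) at the root); §4 Theorem 6 (pp. 25–31)] [cite: BenjaminiSchramm1996, Conj. 4] [this work]
-/

noncomputable section

open scoped Classical

namespace Summit.CriticalPhenomena.PercolationContinuityZ3.Theorems.Transplant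

open MeasureTheory Literature.Probability.Percolation Literature.Probability.LatticeModels SimpleGraph KNCells KNLevels
open SkelConc (Consts)
open Skelφ.StepI (DataN DataNS OutNS)

namespace PlanarSkeletonFrmFrom

namespace NegB

open Neg

set_option maxHeartbeats 1600000 in
/-- **THE GEN (R) COLUMN PROP, ∀ D, AT THE TUPLE OF RECORD UNDER PROXIES** (TUPLE Px OF RECORD, «SkelFrmFromBChoiceSlotsPx»): for every proxy radius `D` and every
`Kmin ≥ 200`, `RootHoldsNQWFnLKPxAt LfQ Kmin (frmChoiceAllQ3VPx D (gvPx D) (fvPx D) (PvPx D) (SUS (exPx D) (mxPx D)) (cvPx D) (hvPx D) BSlot.small3)` — the U (R)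
top's proof at the raised kit index `KS.RK t Dr 0 + D` (see the module docstring). [cite: KozmaNitzan2024, §4 p. 28 ((32) at the root)] -/
theorem rootHoldsNQWFnLKPxAt_frmChoiceAllQ3VPx_node (D Kmin : ℕ) (hKmin : 200 ≤ Kmin) :
    RootHoldsNQWFnLKPxAt LfQ Kmin (frmChoiceAllQ3VPx D (gvPx D) (fvPx D) (PvPx D) (SUS (exPx D) (mxPx D)) (cvPx D) (hvPx D) BSlot.small3) := by
  refine rootHoldsNQWFnLKPxAt_frmChoiceAllQ3VPx_R D Kmin 0 hKmin (gvPx D) (fvPx D) (PvPx D) (exPx D) (mxPx D) (cvPx D) (hvPx D) BSlot.small3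
    ?_ ?_ ?_ ?_ ?_ ?_ ?_ ?_ ?_
  · -- HgR at the raised index
    intro κ V _ _ G _ Φ t p Dr
    rw [gvPx_at, fvPx_at]
    obtain ⟨h1, -, h3⟩ := le_gT_gxQ (KS.RK t Dr 0 + D) (gxR0 (KS.RK t Dr 0 + D)) (fxR (KS.RK t Dr 0 + D)) κ Φ t p Dr
    obtain ⟨g1, g2, -⟩ := gxC_floors κ Φ t p Dr (KS.RK t Dr 0 + D)
    exact ⟨g1.trans h1, g2.trans h1, h3, two_fT_le_gT (KS.RK t Dr 0 + D) (gxR0 (KS.RK t Dr 0 + D)) (fxR (KS.RK t Dr 0 + D)) κ Φ t p Dr⟩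
  · -- HfR
    intro κ V _ _ G _ Φ t p Dr
    rw [fvPx_at]
    exact (le_fT_fxQ (KS.RK t Dr 0 + D) (fxR (KS.RK t Dr 0 + D)) κ Φ t p Dr).2.2
  · -- HexR: the six window floors at the raised index, the long-link and bridge windows at radius `+ D`
    intro κ V _ _ G _ Φ t p Dr g f
    rw [exPx_at]
    have hQ := (le_exQ (KS.RK t Dr 0 + D) (exRD (KS.RK t Dr 0 + D) D) κ Φ t p Dr g f).2.2.2.2
    obtain ⟨h0, hL, hB⟩ := exRD_floors κ Φ t p Dr (KS.RK t Dr 0 + D) D g f hQ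
    obtain ⟨-, -, h3, h4, h5, h6⟩ := exR0_floors κ Φ t p Dr (KS.RK t Dr 0 + D) g f h0
    exact ⟨by omega, hB, h3, h4, h5, h6⟩
  · -- HPx
    intro κ V _ _ G _ Φ t p Dr
    rw [PvPx_at]
    exact (subset_PR_PxQ (KS.RK t Dr 0 + D) κ Φ t p Dr (PxR (KS.RK t Dr 0 + D))).1
  · -- HRs
    intro κ V _ _ G _ Φ t p Dr f hN hκ i
    rw [gvPx_at] at hN hκ ⊢
    have h1 := RA'_le_r_TA κ Φ t p Dr (KS.RK t Dr 0 + D) (gxQ (KS.RK t Dr 0 + D) (gxR0 (KS.RK t Dr 0 + D)) (fxR (KS.RK t Dr 0 + D))) f hN hκ i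
    have h2 := (KS.T₀a_lt_RA' κ Φ t p Dr (KS.RK t Dr 0 + D)).2.1
    have h3 : ((KS.Rs t Dr (KS.RK t Dr 0 + D) : ℕ) : ℤ) + 2 <
        ((fcellsA κ Φ t p Dr ((KS.gT (KS.RK t Dr 0 + D) (gxQ (KS.RK t Dr 0 + D) (gxR0 (KS.RK t Dr 0 + D)) (fxR (KS.RK t Dr 0 + D)))) κ Φ t p Dr) f).r i : ℤ) :=
      lt_of_lt_of_le (by exact_mod_cast h2) h1
    omega
  · -- HX1
    intro κ V _ _ G _ Φ t p hC O q hK hAt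
    have hN := eqNumL_of_atQ (atQ3_of_atQ3V hAt)
    obtain ⟨h1, -, -⟩ := le_gT_gxQ (KS.RK t O.merged 0 + D) (gxR0 (KS.RK t O.merged 0 + D)) (fxR (KS.RK t O.merged 0 + D)) κ Φ t p O.merged
    obtain ⟨g1, g2, -⟩ := gxC_floors κ Φ t p O.merged (KS.RK t O.merged 0 + D)
    exact rowX1_Q κ Φ t p O.merged _ _ (KS.RK t O.merged 0 + D) (PlanarSkeletonNeg.Neg.kq_ge_of_le κ (m := 4) (le_trans (by norm_num) hK)) hN
      (g1.trans h1) (g2.trans h1)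
  · -- HXA
    intro κ V _ _ G _ Φ t p hC O q hK hAt hg
    have hN := eqNumL_of_atQ (atQ3_of_atQ3V hAt)
    obtain ⟨h1, -, -⟩ := le_gT_gxQ (KS.RK t O.merged 0 + D) (gxR0 (KS.RK t O.merged 0 + D)) (fxR (KS.RK t O.merged 0 + D)) κ Φ t p O.merged
    obtain ⟨-, g2, -⟩ := gxC_floors κ Φ t p O.merged (KS.RK t O.merged 0 + D)
    have r := rowXA_Q κ Φ t p O.merged (gOf κ Φ t p O (gvPx D)) (fOf κ Φ t p O (fvPx D)) (KS.RK t O.merged 0 + D)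
      (PlanarSkeletonNeg.Neg.kq_ge_of_le κ (m := 4) (le_trans (by norm_num) hK)) hN hg (g2.trans h1)
    have e := bOf_small3_eq κ Φ t p O (gvPx D) (fvPx D)
    rw [← e] at r
    exact r
  · -- HX2
    intro κ V _ _ G _ Φ t p hC O q hK hAt
    have hN := eqNumL_of_atQ (atQ3_of_atQ3V hAt)
    obtain ⟨h1, -, -⟩ := le_gT_gxQ (KS.RK t O.merged 0 + D) (gxR0 (KS.RK t O.merged 0 + D)) (fxR (KS.RK t O.merged 0 + D)) κ Φ t p O.merged
    obtain ⟨g1, g2, -⟩ := gxC_floors κ Φ t p O.merged (KS.RK t O.merged 0 + D)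
    exact rowX2_Q κ Φ t p O.merged _ _ (KS.RK t O.merged 0 + D) hN (g1.trans h1) (g2.trans h1)
  · -- HYA
    intro κ V _ _ G _ Φ t p hC O q hK hAt hg
    have hN := eqNumL_of_atQ (atQ3_of_atQ3V hAt)
    obtain ⟨h1, -, -⟩ := le_gT_gxQ (KS.RK t O.merged 0 + D) (gxR0 (KS.RK t O.merged 0 + D)) (fxR (KS.RK t O.merged 0 + D)) κ Φ t p O.merged
    obtain ⟨-, g2, -⟩ := gxC_floors κ Φ t p O.merged (KS.RK t O.merged 0 + D)
    have r := rowYA_Q κ Φ t p O.merged (gOf κ Φ t p O (gvPx D)) (fOf κ Φ t p O (fvPx D)) (KS.RK t O.merged 0 + D)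
      (PlanarSkeletonNeg.Neg.kq_ge_of_le κ (m := 4) (le_trans (by norm_num) hK)) hN hg (g2.trans h1)
    have e := bOf_small3_eq κ Φ t p O (gvPx D) (fvPx D)
    rw [← e] at r
    exact r

end NegB

end PlanarSkeletonFrmFrom

end Summit.CriticalPhenomena.PercolationContinuityZ3.Theorems.Transplant

end
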